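import Literature.NumberTheory.EllipticCurves.TakahashiDegreeFormula
import HarnessLib

/-!
# `stub_takahashi` — FAMILY-3 (probe the extremes) helper statements, generation 20, ideator k = 3

Companion to `STUB-IDEAS-stub_takahashi-3.md` (crux `DefiniteRTControlPrime`, stmt-ABC-11338, route
`DefiniteXi`).  Sorry-free: `def … : Prop` cells of the stub
`Literature.NumberTheory.EllipticCurves.takahashi2001_thm_2_3_of_coprime` and trivial implications.
Numerical certificates quoted in the docstrings: kit job `j345565` (prime-level cell by the method
of graphs, tree conventions) and the hand rows `N = 11, 17, 19, 37` of the sheet.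
-/

set_option linter.dupNamespace false

namespace Summit.ABC.ABC.Cruxes.DefiniteRTControlPrime.StubIdeas3G20

open Literature.NumberTheory.EllipticCurves Literature.NumberTheory.EllipticCurves.ModularForms
open Literature.NumberTheory.Automorphic

/-- **H20.1 · the prime-level cell `M = 1`** of the stub (conductor `p` prime, Brandt setups of type
`(1, p)` = maximal orders of the quaternion algebra ramified at `{p, ∞}`; the character group of
`J₀(p)` at `p` = degree-zero divisors on supersingular points, Deligne–Rapoport / Ribet 1990 §3).
The extreme cell where the unit weights `w_i ∈ {1, 2, 3}` are exercised (`j = 1728, 0`). -/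
def takahashi2001_thm_2_3_primeLevel : Prop :=
  ∀ (W : WeierstrassCurve ℚ) [W.IsElliptic] (p : ℕ) [NeZero (1 * p)],
    p.Prime → W.conductorNorm ℤ = 1 * p →
    ∀ P : ModularParametrizationData W (1 * p),
      (∀ (W' : WeierstrassCurve ℚ) [W'.IsElliptic], W'.conductorNorm ℤ = 1 * p →
          ∀ P' : ModularParametrizationData W' (1 * p),
          P'.f = P.f → P.modularDegree ≤ P'.modularDegree) →
      ∀ S : Brandt.XiSetup 1 p,
        ∃ i j : ℕ, 0 < i ∧ i * j = (W.minimalDiscriminantNorm ℤ).factorization p ∧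
          i ∣ S.xi (fun n => W.LFunction n) ∧
          P.modularDegree * i = S.xi (fun n => W.LFunction n) * j

/-- The stub implies its prime-level cell (`M = 1`, `gcd(1, p) = 1`). PROVED. -/
theorem primeLevel_of_stub (h : takahashi2001_thm_2_3_of_coprime) :
    takahashi2001_thm_2_3_primeLevel := by
  intro W _ p _ hp hN P hmin S
  exact h W 1 p hp (Nat.coprime_one_left p) hN P hmin S

/-- **H20.2 · the SHARP prime-level cell (Takahashi ∘ Emerton)**: at prime level the optimal quotient
map on component groups `Φ(J₀(p)) → Φ(E)` is SURJECTIVE (Emerton 2003, optimal quotients of `J₀(p)`),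
so `j_p = 1`, `i_p = c_p`, and Thm. 2.3 collapses to the parameter-free identity
`ξ_S(E; 1, p) = δ_E · c_p` (with `c_p = ord_p Δ_min ≥ 1`).  Hand rows: 11a1 `5 = 1·5`, 17a1 `4 = 1·4`,
19a1 `3 = 1·3`, 37a1 `2 = 2·1`, 37b1 `6 = 2·3`; kit `j345565` all optimal curves of prime conductor
`≤ 400`.  A candidate NAMED FACT (stronger than the cell, not provable in tree either). -/
def takahashi_primeLevel_sharp : Prop :=
  ∀ (W : WeierstrassCurve ℚ) [W.IsElliptic] (p : ℕ) [NeZero (1 * p)],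
    p.Prime → W.conductorNorm ℤ = 1 * p →
    ∀ P : ModularParametrizationData W (1 * p),
      (∀ (W' : WeierstrassCurve ℚ) [W'.IsElliptic], W'.conductorNorm ℤ = 1 * p →
          ∀ P' : ModularParametrizationData W' (1 * p),
          P'.f = P.f → P.modularDegree ≤ P'.modularDegree) →
      ∀ S : Brandt.XiSetup 1 p,
        0 < (W.minimalDiscriminantNorm ℤ).factorization p ∧
          S.xi (fun n => W.LFunction n) =
            P.modularDegree * (W.minimalDiscriminantNorm ℤ).factorization p

/-- The sharp cell implies the stub's prime-level cell, with the witness `(i, j) = (c_p, 1)`. PROVED. -/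
theorem primeLevel_of_sharp (h : takahashi_primeLevel_sharp) :
    takahashi2001_thm_2_3_primeLevel := by
  intro W _ p _ hp hN P hmin S
  obtain ⟨hc, hξ⟩ := h W p hp hN P hmin S
  refine ⟨(W.minimalDiscriminantNorm ℤ).factorization p, 1, hc, by rw [mul_one], ?_, ?_⟩
  · exact ⟨P.modularDegree, by rw [hξ, mul_comm]⟩
  · rw [hξ, mul_one]

/-- **H20.3 · negative knowledge — the `i = 1` specialisation** (`δ = ξ_S · c_r`, i.e. `π_*` zero on
`Φ`): formally STRONGER than the stub (`stub_of_iOne`) and FALSE: 11a1 at `(M, r) = (1, 11)` has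
`δ = 1`, `ξ = 5`, `c = 5` (`(i, j) = (5, 1)`).  Do NOT file as a reshape. -/
def takahashi_iOne : Prop :=
  ∀ (W : WeierstrassCurve ℚ) [W.IsElliptic] (M r : ℕ) [NeZero (M * r)],
    r.Prime → M.Coprime r → W.conductorNorm ℤ = M * r →
    ∀ P : ModularParametrizationData W (M * r),
      (∀ (W' : WeierstrassCurve ℚ) [W'.IsElliptic], W'.conductorNorm ℤ = M * r →
          ∀ P' : ModularParametrizationData W' (M * r),
          P'.f = P.f → P.modularDegree ≤ P'.modularDegree) →
      ∀ S : Brandt.XiSetup M r,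
        P.modularDegree =
          S.xi (fun n => W.LFunction n) * (W.minimalDiscriminantNorm ℤ).factorization r

/-- `i = 1` specialisation ⇒ stub (witness `(1, c_r)`). PROVED; the converse direction is what fails. -/
theorem stub_of_iOne (h : takahashi_iOne) : takahashi2001_thm_2_3_of_coprime := by
  intro W _ M r _ hr hcop hN P hmin S
  refine ⟨1, (W.minimalDiscriminantNorm ℤ).factorization r, one_pos, by rw [one_mul], one_dvd _, ?_⟩
  rw [mul_one]
  exact h W M r hr hcop hN P hmin S

/-- **H20.4 · negative knowledge — the `j = 1` specialisation** (`δ · c_r = ξ_S`, i.e. `π_*` onto on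
`Φ`, the Emerton shape): TRUE at prime level (H20.2) but FALSE at composite Frey levels: the four
certified Frey classes at `(M, r) = (96, 7)`, `N = 672` (kit `j345502`, k3-g19) have
`(δ, c, ξ, i, j) = (64, 2, 32, 1, 2)`, `δ·c = 128 ≠ 32`.  Formally STRONGER than the stub
(`stub_of_jOne`).  With H20.3: the stub's `∃ i j` is irreducibly two-parameter on the consumed cells. -/
def takahashi_jOne : Prop :=
  ∀ (W : WeierstrassCurve ℚ) [W.IsElliptic] (M r : ℕ) [NeZero (M * r)],
    r.Prime → M.Coprime r → W.conductorNorm ℤ = M * r →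
    ∀ P : ModularParametrizationData W (M * r),
      (∀ (W' : WeierstrassCurve ℚ) [W'.IsElliptic], W'.conductorNorm ℤ = M * r →
          ∀ P' : ModularParametrizationData W' (M * r),
          P'.f = P.f → P.modularDegree ≤ P'.modularDegree) →
      ∀ S : Brandt.XiSetup M r,
        0 < (W.minimalDiscriminantNorm ℤ).factorization r ∧
          P.modularDegree * (W.minimalDiscriminantNorm ℤ).factorization r =
            S.xi (fun n => W.LFunction n)

/-- `j = 1` specialisation ⇒ stub (witness `(c_r, 1)`). PROVED; the converse direction is what fails. -/
theorem stub_of_jOne (h : takahashi_jOne) : takahashi2001_thm_2_3_of_coprime := by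
  intro W _ M r _ hr hcop hN P hmin S
  obtain ⟨hc, hδ⟩ := h W M r hr hcop hN P hmin S
  refine ⟨(W.minimalDiscriminantNorm ℤ).factorization r, 1, hc, by rw [mul_one], ?_, ?_⟩
  · exact ⟨P.modularDegree, by rw [← hδ, mul_comm]⟩
  · rw [hδ, mul_one]

/-- **H20.5 · the exact square law behind every certified row** (`δ · c_r = ξ_S · j²`, from
`δ i = ξ j` and `i j = c_r`): the convention-sensitive quantity the g20 certificate tests — at `N = 11`
the typed conventions give `ξ = 5 = δ·c`, while the unweighted / transposed / transposed-unweighted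
readings of the Brandt data give `2 / 35 / 13`, none of the form `δ·c / j²`. PROVED. -/
theorem sq_law (δ ξ c i j : ℕ) (hij : i * j = c) (hdeg : δ * i = ξ * j) : δ * c = ξ * j * j := by
  subst hij
  calc δ * (i * j) = δ * i * j := by rw [mul_assoc]
    _ = ξ * j * j := by rw [hdeg]

end Summit.ABC.ABC.Cruxes.DefiniteRTControlPrime.StubIdeas3G20
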